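import Literature.InformationTheory.QuantumCodes.CSSDisjointLogicals
import HarnessLib

/-!
# The rotated surface code `RSC(L)` on the `L × L` grid: definition, commutation, columns/rows as logical lines

Topic `InformationTheory/QuantumCodes`; namespace `Literature.InformationTheory.QuantumCodes.RotatedSurface`.
LADDER-QEC (cell `qec`), PARTITION row 08, item 08.RSC.

The **rotated surface code** of linear size `L` (Bombin–Martin-Delgado 2007: the planar surface code with `n/d² = 1`,
«(b) with approximately half the number of qubits and equal distance»; Tomita–Svore 2014 §2.2: «rotating [the distance-3
surface code] by 45 degrees and removing the four corner data qubits … Surface-17 … weight-4 and weight-2 stabilizers»):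
data qubits on the vertices `Fin L × Fin L` of an `L × L` grid (row `i`, column `j`); checks on the faces of the grid
extended by one virtual row above/below (for `X`) resp. one virtual column left/right (for `Z`), coloured like a
checkerboard:

* `X`-faces `(a', b) ∈ [0, L] × [0, L−2]` act on rows `{a'−1, a'} ∩ [0, L−1]` and columns `{b, b+1}`; the face is an
  `X`-CHECK iff `a' + b` is odd (interior weight-4 faces of one colour, and the weight-2 checks of the top `a' = 0` and
  bottom `a' = L` boundaries); faces of the other colour index ZERO rows of `HX` (padding — row spaces, kernels, rank,
  `k`, `d_X`, `d_Z`, `IsCode` are unaffected by zero rows, and all index sets stay plain products of `Fin`'s);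
* `Z`-faces `(a, b') ∈ [0, L−2] × [0, L]` act on rows `{a, a+1}` and columns `{b'−1, b'} ∩ [0, L−1]`, and are `Z`-checks
  iff `a + b'` is even (interior faces of the other colour + left/right weight-2 boundary checks); others = zero rows.

This file: `HX`, `HZ` (products of a validity indicator and row/column indicator factors), their commutation
(`HX_mul_HZ_transpose`: an `X`-face and a `Z`-face share `(#common rows)·(#common columns)` qubits, each factor odd only
for neighbours in that direction, and diagonal neighbours have the same colour), the code `code L : CSSCode`, and the
«line» data for the distance engine `CSSCode.dZ_eq_of_disjoint_lines` (`CSSDisjointLogicals.lean`): columns `col j`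
(pairwise disjoint; `col j + col (j+1)` = the product of the `X`-faces of strip `b = j`; `H_Z · col j = 0`), rows `row i`
(symmetrically for `Z`-strips), `⟨row i, col j⟩ = 1`, weights `≤ L`. The parameters `[[L², 1, L]]` are assembled in
`RotatedSurfaceCodeDistance.lean`.

0 named facts, no instances, no notation; axioms standard.

## References
* [BombinMartinDelgado2007Optimal] H. Bombin, M. A. Martin-Delgado, PRA 76 (2007) 012305 = arXiv:quant-ph/0703272, §IV
  (held text p0007 L1-9: «two different versions of the surface code with distance d=5 … (b) … approximately half the
  number of qubits and equal distance … the optimized value for planar surface codes is C_s = 1», `C_s = n/d²`).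
* [TomitaSvore2014] Y. Tomita, K. M. Svore, PRA 90 (2014) 062320 = arXiv:1404.3747, §2.2 (p0004 L45-59: «Surface-17»,
  weight-4/weight-2 stabilizers, «remain distance-three surface codes [Bombin07, Horsman2012]»).
* [DennisEtAl2002] Dennis–Kitaev–Landahl–Preskill §3.2 (planar codes: boundaries of two types, logical paths).
-/

namespace Literature.InformationTheory.QuantumCodes

open Matrix Finset

namespace RotatedSurface

variable {L : ℕ}

/-! ## Faces and check matrices -/

/-- Validity (colour) of an `X`-face `(a', b)`: `a' + b` odd. (definition) [cite: TomitaSvore2014, §2.2 (p0004 L45-48: the X stabilizers of the rotated layout)] -/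
def vx (x : Fin (L + 1) × Fin (L - 1)) : ZMod 2 := if (x.1.val + x.2.val) % 2 = 1 then 1 else 0

/-- Validity of a `Z`-face `(a, b')`: `a + b'` even. (definition) [cite: TomitaSvore2014, §2.2 (p0004 L45-48)] -/
def vz (z : Fin (L - 1) × Fin (L + 1)) : ZMod 2 := if (z.1.val + z.2.val) % 2 = 0 then 1 else 0

/-- Row factor of an `X`-face: `[i ∈ {a'−1, a'}]`. (definition) [cite: TomitaSvore2014, §2.2 (p0004 L45-48)] -/
def rx (x : Fin (L + 1) × Fin (L - 1)) (i : Fin L) : ZMod 2 := if i.val + 1 = x.1.val ∨ i.val = x.1.val then 1 else 0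

/-- Column factor of an `X`-face: `[j ∈ {b, b+1}]`. (definition) [cite: TomitaSvore2014, §2.2 (p0004 L45-48)] -/
def cx (x : Fin (L + 1) × Fin (L - 1)) (j : Fin L) : ZMod 2 := if j.val = x.2.val ∨ j.val = x.2.val + 1 then 1 else 0

/-- Row factor of a `Z`-face: `[i ∈ {a, a+1}]`. (definition) [cite: TomitaSvore2014, §2.2 (p0004 L45-48)] -/
def rz (z : Fin (L - 1) × Fin (L + 1)) (i : Fin L) : ZMod 2 := if i.val = z.1.val ∨ i.val = z.1.val + 1 then 1 else 0

/-- Column factor of a `Z`-face: `[j ∈ {b'−1, b'}]`. (definition) [cite: TomitaSvore2014, §2.2 (p0004 L45-48)] -/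
def cz (z : Fin (L - 1) × Fin (L + 1)) (j : Fin L) : ZMod 2 := if j.val + 1 = z.2.val ∨ j.val = z.2.val then 1 else 0

/-- The `X`-check matrix of `RSC(L)` (zero rows at faces of the wrong colour): `H_X[x, (i,j)] = [x valid][i ∈ rows x][j ∈ cols x]`.
(definition) [cite: TomitaSvore2014, §2.2 (p0004 L45-59: X stabilizers of Surface-17)] -/
def HX (L : ℕ) : Matrix (Fin (L + 1) × Fin (L - 1)) (Fin L × Fin L) (ZMod 2) := fun x q => vx x * (rx x q.1 * cx x q.2)

/-- The `Z`-check matrix of `RSC(L)` (zero rows at faces of the wrong colour). (definition)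
[cite: TomitaSvore2014, §2.2 (p0004 L45-59: Z stabilizers of Surface-17)] -/
def HZ (L : ℕ) : Matrix (Fin (L - 1) × Fin (L + 1)) (Fin L × Fin L) (ZMod 2) := fun z q => vz z * (rz z q.1 * cz z q.2)

/-- A sum over `Fin n` against the indicator of two consecutive values `u, u+1 < n` picks out those two terms.
[cite: DennisEtAl2002, §3.2 (a face of the square lattice meets two consecutive rows and columns)] -/
theorem sum_mul_pair_indicator {n : ℕ} (f : Fin n → ZMod 2) (u : ℕ) (hu : u + 1 < n) :
    ∑ i : Fin n, f i * (if i.val = u ∨ i.val = u + 1 then 1 else 0) = f ⟨u, by omega⟩ + f ⟨u + 1, hu⟩ := by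
  rw [Finset.sum_eq_add (⟨u, by omega⟩ : Fin n) ⟨u + 1, hu⟩]
  · simp
  · intro h; simp [Fin.ext_iff] at h
  · intro i _ hi
    have h1 : i.val ≠ u := fun h => hi.1 (Fin.ext h)
    have h2 : i.val ≠ u + 1 := fun h => hi.2 (Fin.ext h)
    simp [h1, h2]
  · simp
  · simp

/-- The two variants with the consecutive values written `u+1 = ·`/`· = u`: `Σ_i f i · [i+1 = v ∨ i = v]` over `Fin n`,
for `v ≤ n`, `0 < n`, is the sum of the (at most two) terms `i = v−1`, `i = v` that exist. We only need it in the
product form below; this helper evaluates the row sum of an `X`-face against a second indicator pair.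
[cite: DennisEtAl2002, §3.2] -/
theorem sum_rx_mul_rz (x : Fin (L + 1) × Fin (L - 1)) (z : Fin (L - 1) × Fin (L + 1)) :
    ∑ i : Fin L, rx x i * rz z i
      = (if z.1.val + 1 = x.1.val ∨ z.1.val = x.1.val then 1 else 0)
        + (if z.1.val + 2 = x.1.val ∨ z.1.val + 1 = x.1.val then 1 else 0) := by
  have hc : z.1.val + 1 < L := by have := z.1.isLt; omega
  simp only [rz]
  rw [sum_mul_pair_indicator _ z.1.val hc]
  simp only [rx]

/-- Column analogue: the column sum of an `X`-face against a `Z`-face. [cite: DennisEtAl2002, §3.2] -/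
theorem sum_cx_mul_cz (x : Fin (L + 1) × Fin (L - 1)) (z : Fin (L - 1) × Fin (L + 1)) :
    ∑ j : Fin L, cx x j * cz z j
      = (if x.2.val + 1 = z.2.val ∨ x.2.val = z.2.val then 1 else 0)
        + (if x.2.val + 2 = z.2.val ∨ x.2.val + 1 = z.2.val then 1 else 0) := by
  have hb : x.2.val + 1 < L := by have := x.2.isLt; omega
  have e : ∀ j : Fin L, cx x j * cz z j = cz z j * (if j.val = x.2.val ∨ j.val = x.2.val + 1 then 1 else 0) := fun j => by
    simp only [cx]; ring
  simp_rw [e]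
  rw [sum_mul_pair_indicator _ x.2.val hb]
  simp only [cz]

/-- **Commutation**: `H_X H_Zᵀ = 0`. [cite: TomitaSvore2014, §2.2 (p0004 L59: the rotated layouts «remain … surface codes» — commuting stabilizers)] -/
theorem HX_mul_HZ_transpose (L : ℕ) : HX L * (HZ L)ᵀ = 0 := by
  ext x z
  simp only [Matrix.mul_apply, Matrix.transpose_apply, HX, HZ, Matrix.zero_apply]
  rw [Fintype.sum_prod_type]
  have hsplit : ∑ i : Fin L, ∑ j : Fin L, vx x * (rx x i * cx x j) * (vz z * (rz z i * cz z j))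
      = vx x * vz z * ((∑ i : Fin L, rx x i * rz z i) * (∑ j : Fin L, cx x j * cz z j)) := by
    rw [Finset.sum_mul_sum, Finset.mul_sum]
    refine Finset.sum_congr rfl fun i _ => ?_
    rw [Finset.mul_sum]
    refine Finset.sum_congr rfl fun j _ => by ring
  rw [hsplit, sum_rx_mul_rz, sum_cx_mul_cz]
  simp only [vx, vz]
  split_ifs <;> first | decide | (exfalso; omega)

/-- **The rotated surface code `RSC(L)`** as a check-matrix CSS code on the `L × L` grid. (definition)
[cite: BombinMartinDelgado2007Optimal, §IV (p0007 L1-9: the planar surface code with n/d² = 1)] [cite: TomitaSvore2014, §2.2 (p0004 L45-59: Surface-17 = the rotated distance-3 layout)] -/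
def code (L : ℕ) : CSSCode (Fin (L + 1) × Fin (L - 1)) (Fin (L - 1) × Fin (L + 1)) (Fin L × Fin L) :=
  CSSCode.ofMatrices (HX L) (HZ L) (HX_mul_HZ_transpose L)

/-- `(code L).HX = HX L`. [cite: TomitaSvore2014, §2.2 (p0004 L45-59)] -/
@[simp] theorem code_HX (L : ℕ) : (code L).HX = HX L := rfl

/-- `(code L).HZ = HZ L`. [cite: TomitaSvore2014, §2.2 (p0004 L45-59)] -/
@[simp] theorem code_HZ (L : ℕ) : (code L).HZ = HZ L := rfl

/-- The number of qubits is `L²`. [cite: BombinMartinDelgado2007Optimal, §IV (p0007 L1-9: n = d²)] -/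
theorem card_qubits (L : ℕ) : Fintype.card (Fin L × Fin L) = L * L := by simp

/-! ## Rows and columns: the logical lines -/

/-- The indicator of column `j`. (definition) [cite: DennisEtAl2002, §3.2 (a logical path joining the two boundaries of one type)] -/
def col (j : Fin L) : Fin L × Fin L → ZMod 2 := fun q => if q.2 = j then 1 else 0

/-- The indicator of row `i`. (definition) [cite: DennisEtAl2002, §3.2] -/
def row (i : Fin L) : Fin L × Fin L → ZMod 2 := fun q => if q.1 = i then 1 else 0

/-- Distinct columns have disjoint supports. [cite: DennisEtAl2002, §3.2] -/
theorem col_disjoint (j j' : Fin L) (h : j ≠ j') (q : Fin L × Fin L) : col j q = 0 ∨ col j' q = 0 := by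
  by_cases hq : q.2 = j
  · right; simp [col, hq, h]
  · left; simp [col, hq]

/-- Distinct rows have disjoint supports. [cite: DennisEtAl2002, §3.2] -/
theorem row_disjoint (i i' : Fin L) (h : i ≠ i') (q : Fin L × Fin L) : row i q = 0 ∨ row i' q = 0 := by
  by_cases hq : q.1 = i
  · right; simp [row, hq, h]
  · left; simp [row, hq]

/-- `⟨row i, col j⟩ = 1`: a row and a column share exactly the qubit `(i, j)`. [cite: DennisEtAl2002, §3.2 (X̄ and Z̄ paths cross once)] -/
theorem row_dotProduct_col (i j : Fin L) : row i ⬝ᵥ col j = 1 := by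
  simp only [dotProduct, row, col]
  rw [Fintype.sum_prod_type]
  simp only [mul_ite, mul_one, mul_zero]
  rw [Finset.sum_comm]
  simp [Finset.sum_ite_eq']

/-- `⟨col j, row i⟩ = 1`. [cite: DennisEtAl2002, §3.2] -/
theorem col_dotProduct_row (i j : Fin L) : col j ⬝ᵥ row i = 1 := by
  rw [dotProduct_comm]; exact row_dotProduct_col i j

/-- A row has weight at most `L`. [cite: DennisEtAl2002, §3.2 (a logical path of L links)] -/
theorem hammingNorm_row_le (i : Fin L) : hammingNorm (row i) ≤ L := by
  unfold hammingNorm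
  calc (Finset.univ.filter fun q : Fin L × Fin L => row i q ≠ 0).card
      ≤ (Finset.univ.image fun j : Fin L => (i, j)).card := by
        refine Finset.card_le_card fun q hq => ?_
        simp only [Finset.mem_filter, Finset.mem_univ, true_and, row, ne_eq, ite_eq_right_iff, one_ne_zero,
          imp_false, not_not] at hq
        exact Finset.mem_image.2 ⟨q.2, Finset.mem_univ _, by rw [← hq]⟩
    _ ≤ Fintype.card (Fin L) := Finset.card_image_le.trans (by simp)
    _ = L := Fintype.card_fin L

/-- A column has weight at most `L`. [cite: DennisEtAl2002, §3.2] -/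
theorem hammingNorm_col_le (j : Fin L) : hammingNorm (col j) ≤ L := by
  unfold hammingNorm
  calc (Finset.univ.filter fun q : Fin L × Fin L => col j q ≠ 0).card
      ≤ (Finset.univ.image fun i : Fin L => (i, j)).card := by
        refine Finset.card_le_card fun q hq => ?_
        simp only [Finset.mem_filter, Finset.mem_univ, true_and, col, ne_eq, ite_eq_right_iff, one_ne_zero,
          imp_false, not_not] at hq
        exact Finset.mem_image.2 ⟨q.1, Finset.mem_univ _, by rw [← hq]⟩
    _ ≤ Fintype.card (Fin L) := Finset.card_image_le.trans (by simp)
    _ = L := Fintype.card_fin L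

/-- Row sum of a column factor pair: `Σ_j cx x j · [j = j₀] = cx x j₀`-type evaluations packaged: the sum of the column
factor of an `X`-face over its two columns is `1 + 1 = 0`. [cite: DennisEtAl2002, §3.2] -/
theorem sum_cx (x : Fin (L + 1) × Fin (L - 1)) : ∑ j : Fin L, cx x j = 0 := by
  have hb : x.2.val + 1 < L := by have := x.2.isLt; omega
  have e : ∀ j : Fin L, cx x j = 1 * (if j.val = x.2.val ∨ j.val = x.2.val + 1 then 1 else 0) := fun j => by simp [cx]
  simp_rw [e]
  rw [sum_mul_pair_indicator _ x.2.val hb]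
  exact CharTwo.add_self_eq_zero _

/-- The sum of the row factor of a `Z`-face over its two rows is `0`. [cite: DennisEtAl2002, §3.2] -/
theorem sum_rz (z : Fin (L - 1) × Fin (L + 1)) : ∑ i : Fin L, rz z i = 0 := by
  have hc : z.1.val + 1 < L := by have := z.1.isLt; omega
  have e : ∀ i : Fin L, rz z i = 1 * (if i.val = z.1.val ∨ i.val = z.1.val + 1 then 1 else 0) := fun i => by simp [rz]
  simp_rw [e]
  rw [sum_mul_pair_indicator _ z.1.val hc]
  exact CharTwo.add_self_eq_zero _

/-- `H_X · row i = 0`: every `X`-face meets a row in `0` or `2` qubits. [cite: DennisEtAl2002, §3.2 (a Z-type path along a row commutes with the X checks)] -/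
theorem HX_mulVec_row (i : Fin L) : HX L *ᵥ row i = 0 := by
  funext x
  simp only [mulVec, dotProduct, HX, row, Pi.zero_apply]
  rw [Fintype.sum_prod_type]
  simp only [mul_ite, mul_one, mul_zero]
  have hin : ∀ i' : Fin L, ∑ j : Fin L, (if i' = i then vx x * (rx x i' * cx x j) else 0)
      = if i' = i then vx x * rx x i' * ∑ j : Fin L, cx x j else 0 := by
    intro i'
    split_ifs
    · rw [Finset.mul_sum]; exact Finset.sum_congr rfl fun j _ => by ring
    · simp
  simp_rw [hin, sum_cx]
  simp

/-- `H_Z · col j = 0`: every `Z`-face meets a column in `0` or `2` qubits. [cite: DennisEtAl2002, §3.2 (an X-type path along a column commutes with the Z checks)] -/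
theorem HZ_mulVec_col (j : Fin L) : HZ L *ᵥ col j = 0 := by
  funext z
  simp only [mulVec, dotProduct, HZ, col, Pi.zero_apply]
  rw [Fintype.sum_prod_type, Finset.sum_comm]
  simp only [mul_ite, mul_one, mul_zero]
  have hin : ∀ j' : Fin L, ∑ i : Fin L, (if j' = j then vz z * (rz z i * cz z j') else 0)
      = if j' = j then vz z * cz z j' * ∑ i : Fin L, rz z i else 0 := by
    intro j'
    split_ifs
    · rw [Finset.mul_sum]; exact Finset.sum_congr rfl fun i _ => by ring
    · simp
  simp_rw [hin, sum_rz]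
  simp

/-- **Strip lemma, columns**: for consecutive columns, `col j + col (j+1) = Σ_{a'} H_X (a', j)` (each qubit of the two
columns lies in exactly one `X`-CHECK of the strip `b = j`), hence `col j + col (j+1) ∈ rs H_X`.
[cite: DennisEtAl2002, §3.2 (neighbouring logical paths differ by the stabilizers between them)] -/
theorem col_add_col_mem_rowSpX (j j' : Fin L) (hj : j'.val = j.val + 1) : col j + col j' ∈ (code L).rowSpX := by
  have hjL : j.val < L - 1 := by have := j'.isLt; omega
  set b : Fin (L - 1) := ⟨j.val, hjL⟩ with hb
  refine mem_rowSpace_of_vecMul_eq (fun x : Fin (L + 1) × Fin (L - 1) => if x.2 = b then 1 else 0) ?_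
  funext q
  obtain ⟨i, k⟩ := q
  simp only [vecMul, dotProduct, code_HX, HX, Pi.add_apply, col]
  rw [Fintype.sum_prod_type]
  simp only [ite_mul, one_mul, zero_mul, Finset.sum_ite_eq', Finset.mem_univ, if_true]
  -- the sum over `a'` of `vx (a', b) · rx (a', b) i` is `1`; `cx (·, b) k = [k ∈ {j, j+1}]`
  have hck : ∀ a' : Fin (L + 1), cx (a', b) k = (if k = j then 1 else 0) + (if k = j' then 1 else 0) := by
    intro a'
    simp only [cx, hb, Fin.ext_iff, hj]
    split_ifs <;> first | (exfalso; omega) | simp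
  have hsum : ∑ a' : Fin (L + 1), vx (a', b) * (rx (a', b) i * cx (a', b) k)
      = (∑ a' : Fin (L + 1), vx (a', b) * rx (a', b) i) * ((if k = j then 1 else 0) + (if k = j' then 1 else 0)) := by
    rw [Finset.sum_mul]
    exact Finset.sum_congr rfl fun a' _ => by rw [hck]; ring
  have hi : i.val + 1 < L + 1 := by have := i.isLt; omega
  have hone : ∑ a' : Fin (L + 1), vx (a', b) * rx (a', b) i = 1 := by
    have e : ∀ a' : Fin (L + 1), vx (a', b) * rx (a', b) i
        = vx (a', b) * (if a'.val = i.val ∨ a'.val = i.val + 1 then 1 else 0) := fun a' => by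
      simp only [rx]
      congr 1
      split_ifs <;> first | rfl | (exfalso; omega)
    simp_rw [e]
    rw [sum_mul_pair_indicator _ i.val hi]
    simp only [vx, hb]
    split_ifs <;> first | decide | (exfalso; omega)
  rw [hsum, hone, one_mul]

/-- **Strip lemma, rows**: `row i + row (i+1) = Σ_{b'} H_Z (i, b')`, hence `∈ rs H_Z`.
[cite: DennisEtAl2002, §3.2 (neighbouring logical paths differ by the stabilizers between them)] -/
theorem row_add_row_mem_rowSpZ (i i' : Fin L) (hi : i'.val = i.val + 1) : row i + row i' ∈ (code L).rowSpZ := by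
  have hiL : i.val < L - 1 := by have := i'.isLt; omega
  set a : Fin (L - 1) := ⟨i.val, hiL⟩ with ha
  refine mem_rowSpace_of_vecMul_eq (fun z : Fin (L - 1) × Fin (L + 1) => if z.1 = a then 1 else 0) ?_
  funext q
  obtain ⟨r, k⟩ := q
  simp only [vecMul, dotProduct, code_HZ, HZ, Pi.add_apply, row]
  rw [Fintype.sum_prod_type, Finset.sum_comm]
  simp only [ite_mul, one_mul, zero_mul, Finset.sum_ite_eq', Finset.mem_univ, if_true]
  have hrk : ∀ b' : Fin (L + 1), rz (a, b') r = (if r = i then 1 else 0) + (if r = i' then 1 else 0) := by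
    intro b'
    simp only [rz, ha, Fin.ext_iff, hi]
    split_ifs <;> first | (exfalso; omega) | simp
  have hsum : ∑ b' : Fin (L + 1), vz (a, b') * (rz (a, b') r * cz (a, b') k)
      = (∑ b' : Fin (L + 1), vz (a, b') * cz (a, b') k) * ((if r = i then 1 else 0) + (if r = i' then 1 else 0)) := by
    rw [Finset.sum_mul]
    exact Finset.sum_congr rfl fun b' _ => by rw [hrk]; ring
  have hk : k.val + 1 < L + 1 := by have := k.isLt; omega
  have hone : ∑ b' : Fin (L + 1), vz (a, b') * cz (a, b') k = 1 := by
    have e : ∀ b' : Fin (L + 1), vz (a, b') * cz (a, b') k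
        = vz (a, b') * (if b'.val = k.val ∨ b'.val = k.val + 1 then 1 else 0) := fun b' => by
      simp only [cz]
      congr 1
      split_ifs <;> first | rfl | (exfalso; omega)
    simp_rw [e]
    rw [sum_mul_pair_indicator _ k.val hk]
    simp only [vz, ha]
    split_ifs <;> first | decide | (exfalso; omega)
  rw [hsum, hone, one_mul]

end RotatedSurface

end Literature.InformationTheory.QuantumCodes
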